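import Summits.AtomisticToContinuum.Crystallization.Theorems.FrustratedLawDichotomyTransportPriceEquilibrium

/-!
# FrustratedLawDichotomy · crux `AperiodicFrustratedLawGap` (stmt-AtomisticToContinuum-27623) — THE SURPLUS AS A REAL INTEGRAL (FINITE SUM) AND ITS DOOR
# (decomp-a2c, prover hand 2, structural share, generation 3)

The surplus-sharing price of `…TransportPriceSurplus` / `…TransportPriceEquilibrium` was stated as «negative part `<` positive part» of two
`lintegral`s.  Here it is identified with the honest finite sum: on a rooted `7/10`-hard-core configuration `μ` and for `r > 0`,

  `POS.toReal − NEG.toReal = ∫_{B̄_r(0)} (rootEnergy(θ_y μ) − e) / (μ(B̄_r(y))) dμ(y) = Σ_{atoms y, ‖y‖ ≤ r} (h(θ_y μ) − e)/n_r(y)`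

(`surplus_toReal_sub_eq_integral`: the integrand is bounded and a.e. equal to a measurable re-rooting section, the measure `μ|B̄_r` is
finite), and the door is restated with the REAL-INTEGRAL child (`aperiodicFrustratedLawGap_of_realSurplusPrice`, registered-stub and
`PeriodicChargeSplit` versions): for every `δ > 0` and texture radii there is `r > 0` with
`0 < ∫_{B̄_r(0)} (rootEnergy(θ_y μ) − e⋆)/μ(B̄_r(y)) dμ(y)` for every admissible rooted configuration (δ- and 7/10-hard-core, texture-charged,
Nash, force balance, Laplacian stability, near neighbour, infinite, non-periodic).  All `[folklore]`.
-/

noncomputable section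

namespace Summit.AtomisticToContinuum.Crystallization.Theorems.FrustratedLawDichotomyTransportPriceReal

open MeasureTheory Metric Set Filter
open scoped ENNReal Topology BigOperators
open Literature.MathematicalPhysics.StatisticalMechanics Literature.Probability.Process
open Summit.AtomisticToContinuum.Crystallization.Theorems.ChargedEnergyGapNegative (E3 eStar)
open Summit.AtomisticToContinuum.Crystallization.Theorems.FrustratedLawDichotomyFiniteClusterGap
  (ae_mem_of_sep measurable_ofReal_lennardJones_parts measurable_reroot_section)
open Summit.AtomisticToContinuum.Crystallization.Theorems.FrustratedLawDichotomyTransportPriceLocal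
  (rootEnergy_eq_parts rootEnergy_add_c0_nonneg rootEnergy_le_C0)
open Summit.AtomisticToContinuum.Crystallization.Theorems.FrustratedLawDichotomyTransportPriceEquilibrium
  (eStar_lt_integral_rootEnergy_of_ae_surplusSharing)
open Summit.AtomisticToContinuum.Crystallization.Theorems.FrustratedLawDichotomyHardCoreUpgrade (ae_isRootedHardCore_upgrade)
open Summit.AtomisticToContinuum.Crystallization.Theorems.FrustratedLawDichotomyAperiodicGapFiniteCut (ae_infinite_of_minimising_of_decl)
open Summit.AtomisticToContinuum.Crystallization.Theorems.FrustratedLawDichotomyErgodicReduction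
  (aperiodicFrustratedLawGap_iff_ergodicCase periodicChargeSplit_aperiodicFrustratedLawGap_iff_ergodicCase)
open Summit.AtomisticToContinuum.Crystallization.Theorems.FrustratedLawDichotomyNashForceBalance (ae_forceBalance_of_nash)
open Summit.AtomisticToContinuum.Crystallization.Theorems.FrustratedLawDichotomyNashLocalStability
  (ae_laplacian_nonneg_of_nash ae_exists_near_of_nash)
open Literature.Probability.Process.LocalConfig (finite_inter_of_separated)

section Real

variable {μ : Measure E3}

/-- **The surplus is a finite real sum.**  On a rooted `7/10`-hard-core configuration `μ`, for `r > 0` and any reference level `e`, the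
positive and negative parts of the `#B̄_r`-weighted local surplus recombine into the real integral
`∫_{B̄_r(0)} (rootEnergy(θ_y μ) − e)/(θ_y μ)(B̄_r(0)) dμ(y)` (a finite sum over the atoms of the ball). [folklore] -/
theorem surplus_toReal_sub_eq_integral (hμ : IsRootedHardCore (7 / 10) μ) {r : ℝ} (hr : 0 < r) (e : ℝ) :
    Integrable (fun y : E3 => (rootEnergy lennardJones (μ.map fun z : E3 => z - y) - e) /
        ((μ.map fun z : E3 => z - y) (closedBall (0 : E3) r)).toReal) (μ.restrict (closedBall (0 : E3) r)) ∧
    (∫⁻ y in closedBall (0 : E3) r, ENNReal.ofReal (rootEnergy lennardJones (μ.map fun z : E3 => z - y) - e) /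
        (μ.map fun z : E3 => z - y) (closedBall (0 : E3) r) ∂μ).toReal -
      (∫⁻ y in closedBall (0 : E3) r, ENNReal.ofReal (e - rootEnergy lennardJones (μ.map fun z : E3 => z - y)) /
        (μ.map fun z : E3 => z - y) (closedBall (0 : E3) r) ∂μ).toReal =
      ∫ y in closedBall (0 : E3) r, (rootEnergy lennardJones (μ.map fun z : E3 => z - y) - e) /
        ((μ.map fun z : E3 => z - y) (closedBall (0 : E3) r)).toReal ∂μ := by
  classical
  have h7 : (0 : ℝ) < 7 / 10 := by norm_num
  obtain ⟨S, h0S, hsep, hμS⟩ := id hμ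
  obtain ⟨hpm, hmm⟩ := measurable_ofReal_lennardJones_parts
  -- atoms: a.e. `y ∈ S`, re-rooted configurations are hard-core, ball counts are finite and `≥ 1`
  have hS : ∀ᵐ y ∂(μ.restrict (closedBall (0 : E3) r)), y ∈ S :=
    ae_restrict_of_ae (by rw [hμS]; exact ae_mem_of_sep h7 hsep)
  have hθ : ∀ y ∈ S, IsRootedHardCore (7 / 10) (μ.map fun z : E3 => z - y) := fun y hy =>
    hμ.map_sub (by rw [hμS]; exact (count_restrict_singleton_ne_zero_iff S y).mpr hy)
  have hNpos : ∀ ν : Measure E3, IsRootedHardCore (7 / 10) ν → ν (closedBall (0 : E3) r) ≠ 0 ∧ ν (closedBall (0 : E3) r) ≠ ∞ := by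
    intro ν hν
    obtain ⟨T, h0T, hsepT, rfl⟩ := hν
    refine ⟨?_, ?_⟩
    · rw [Measure.restrict_apply measurableSet_closedBall]
      exact Measure.count_ne_zero ⟨0, mem_closedBall_self hr.le, h0T⟩
    · rw [Measure.restrict_apply measurableSet_closedBall,
        Measure.count_apply_finite _ (finite_inter_of_separated h7 hsepT (isCompact_closedBall (0 : E3) r))]
      exact ENNReal.natCast_ne_top _
  -- finiteness of `μ|B̄_r`
  haveI : IsFiniteMeasure (μ.restrict (closedBall (0 : E3) r)) := by
    refine ⟨?_⟩
    rw [Measure.restrict_apply_univ]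
    exact (hNpos μ hμ).2.lt_top
  -- measurable surrogate of the integrand as a re-rooting section
  set G : Measure E3 → E3 → ℝ≥0∞ := fun ν _ => ∫⁻ z, ENNReal.ofReal (lennardJones ‖z‖) ∂ν with hG
  set G' : Measure E3 → E3 → ℝ≥0∞ := fun ν _ => ∫⁻ z, ENNReal.ofReal (-lennardJones ‖z‖) ∂ν with hG'
  set K : Measure E3 → E3 → ℝ≥0∞ := fun ν _ => ν (closedBall (0 : E3) r) with hK
  have hGm : Measurable (Function.uncurry G) := (Measure.measurable_lintegral hpm).comp measurable_fst
  have hG'm : Measurable (Function.uncurry G') := (Measure.measurable_lintegral hmm).comp measurable_fst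
  have hKm : Measurable (Function.uncurry K) := (Measure.measurable_coe measurableSet_closedBall).comp measurable_fst
  have hsec := measurable_reroot_section h7 hμ hGm
  have hsec' := measurable_reroot_section h7 hμ hG'm
  have hsecK := measurable_reroot_section h7 hμ hKm
  set g : E3 → ℝ := fun y => (rootEnergy lennardJones (μ.map fun z : E3 => z - y) - e) /
    ((μ.map fun z : E3 => z - y) (closedBall (0 : E3) r)).toReal with hg
  have hgm : AEStronglyMeasurable g (μ.restrict (closedBall (0 : E3) r)) := by
    refine ⟨fun y => (((G (μ.map fun z : E3 => z - y) (-y)).toReal - (G' (μ.map fun z : E3 => z - y) (-y)).toReal) / 2 - e) /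
      (K (μ.map fun z : E3 => z - y) (-y)).toReal, ?_, ?_⟩
    · exact ((((hsec.ennreal_toReal.sub hsec'.ennreal_toReal).div_const 2).sub_const e).div
        hsecK.ennreal_toReal).stronglyMeasurable
    · filter_upwards [hS] with y hy
      simp only [hg, hG, hG', hK]
      rw [(rootEnergy_eq_parts h7 (hθ y hy)).2.2]
  have hgb : ∀ᵐ y ∂(μ.restrict (closedBall (0 : E3) r)), ‖g y‖ ≤ 250 / 24 * (10 / 7) ^ 12 + 250 / 12 * (10 / 7) ^ 6 + |e| := by
    filter_upwards [hS] with y hy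
    have hθy := hθ y hy
    obtain ⟨hN0, hNt⟩ := hNpos _ hθy
    have hN1 : 1 ≤ ((μ.map fun z : E3 => z - y) (closedBall (0 : E3) r)).toReal := by
      have h01 : (μ.map fun z : E3 => z - y) {(0 : E3)} = 1 := hθy.measure_zero_singleton
      have hle : (μ.map fun z : E3 => z - y) {(0 : E3)} ≤ (μ.map fun z : E3 => z - y) (closedBall (0 : E3) r) :=
        measure_mono (singleton_subset_iff.mpr (mem_closedBall_self hr.le))
      rw [h01] at hle
      have := ENNReal.toReal_mono hNt hle
      simpa using this
    have hup := rootEnergy_le_C0 hθy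
    have hlo := rootEnergy_add_c0_nonneg hθy
    simp only [hg, Real.norm_eq_abs, abs_div]
    rw [abs_of_pos (show (0 : ℝ) < ((μ.map fun z : E3 => z - y) (closedBall (0 : E3) r)).toReal by linarith)]
    calc |rootEnergy lennardJones (μ.map fun z : E3 => z - y) - e| / ((μ.map fun z : E3 => z - y) (closedBall (0 : E3) r)).toReal
        ≤ |rootEnergy lennardJones (μ.map fun z : E3 => z - y) - e| := div_le_self (abs_nonneg _) hN1
      _ ≤ |rootEnergy lennardJones (μ.map fun z : E3 => z - y)| + |e| := abs_sub _ _
      _ ≤ 250 / 24 * (10 / 7) ^ 12 + 250 / 12 * (10 / 7) ^ 6 + |e| := by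
          have : |rootEnergy lennardJones (μ.map fun z : E3 => z - y)| ≤ 250 / 24 * (10 / 7) ^ 12 + 250 / 12 * (10 / 7) ^ 6 :=
            abs_le.mpr ⟨by linarith, by linarith [show (0:ℝ) ≤ 250 / 12 * (10 / 7) ^ 6 by positivity]⟩
          linarith
  have hgi : Integrable g (μ.restrict (closedBall (0 : E3) r)) := Integrable.of_bound hgm _ hgb
  refine ⟨hgi, ?_⟩
  -- the two lintegrals are the positive and negative parts of `g`
  have hpos : ∫⁻ y in closedBall (0 : E3) r, ENNReal.ofReal (rootEnergy lennardJones (μ.map fun z : E3 => z - y) - e) /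
      (μ.map fun z : E3 => z - y) (closedBall (0 : E3) r) ∂μ = ∫⁻ y in closedBall (0 : E3) r, ENNReal.ofReal (g y) ∂μ := by
    refine lintegral_congr_ae ?_
    filter_upwards [hS] with y hy
    obtain ⟨hN0, hNt⟩ := hNpos _ (hθ y hy)
    simp only [hg]
    rw [ENNReal.ofReal_div_of_pos (ENNReal.toReal_pos hN0 hNt), ENNReal.ofReal_toReal hNt]
  have hneg : ∫⁻ y in closedBall (0 : E3) r, ENNReal.ofReal (e - rootEnergy lennardJones (μ.map fun z : E3 => z - y)) /
      (μ.map fun z : E3 => z - y) (closedBall (0 : E3) r) ∂μ = ∫⁻ y in closedBall (0 : E3) r, ENNReal.ofReal (-g y) ∂μ := by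
    refine lintegral_congr_ae ?_
    filter_upwards [hS] with y hy
    obtain ⟨hN0, hNt⟩ := hNpos _ (hθ y hy)
    simp only [hg]
    rw [← neg_div, neg_sub, ENNReal.ofReal_div_of_pos (ENNReal.toReal_pos hN0 hNt), ENNReal.ofReal_toReal hNt]
  rw [hpos, hneg, integral_eq_lintegral_pos_part_sub_lintegral_neg_part hgi]

end Real

/-! ## The real-integral surplus door -/

/-- **REAL-SURPLUS DOOR (crux, by name).**  `AperiodicFrustratedLawGap` follows from: for every `δ > 0` and texture radii `R₇ R₈ R₉` there is
`r > 0` such that every admissible rooted configuration (δ- and 7/10-hard-core, texture-charged, Nash, force balance, Laplacian stability, near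
neighbour, infinite, non-periodic) has `0 < ∫_{B̄_r(0)} (rootEnergy(θ_y μ) − e⋆)/μ(B̄_r(y)) dμ(y)` — the finite sum
`Σ_{atoms y, ‖y‖ ≤ r} (h(θ_y μ) − e⋆)/n_r(y)`. [folklore] -/
theorem aperiodicFrustratedLawGap_of_realSurplusPrice
    (h : ∀ δ : ℝ, 0 < δ → ∀ R₇ R₈ R₉ : ℝ, let Gy : ℝ → (N : ℕ) → (Fin N → EuclideanSpace ℝ (Fin 3)) → Fin N → Prop := fun η N y j => let d : ℝ := sInf ((fun z => dist z (y (j : Fin N))) '' (Set.range (y) \ {(y (j : Fin N))})); let T : Set (EuclideanSpace ℝ (Fin 3)) := {z : EuclideanSpace ℝ (Fin 3) | z ∈ Set.range (y) ∧ z ≠ (y (j : Fin N)) ∧ dist z (y (j : Fin N)) < 13 / 10 * d}; ∃ A : EuclideanSpace ℝ (Fin 3) →ₗᵢ[ℝ] EuclideanSpace ℝ (Fin 3), (∃ e : ↥T ≃ ↥Literature.Geometry.DiscreteGeometry.fccKissingPattern, ∀ t : ↥T, dist (d⁻¹ • ((t : EuclideanSpace ℝ (Fin 3)) - (y (j : Fin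 N)))) (A ((e t : ↥Literature.Geometry.DiscreteGeometry.fccKissingPattern) : EuclideanSpace ℝ (Fin 3))) ≤ η) ∨ (∃ e : ↥T ≃ ↥Literature.Geometry.DiscreteGeometry.hcpKissingPattern, ∀ t : ↥T, dist (d⁻¹ • ((t : EuclideanSpace ℝ (Fin 3)) - (y (j : Fin N)))) (A ((e t : ↥Literature.Geometry.DiscreteGeometry.hcpKissingPattern) : EuclideanSpace ℝ (Fin 3))) ≤ η); let TexBall : (N : ℕ) → (Fin N → EuclideanSpace ℝ (Fin 3)) → Fin N → ℝ → ℝ → ℝ → ℝ → Prop := fun N y i R R₇ R₈ R₉ => (∀ a b : Fin N, a ≠ b → (7 : ℝ) / 10 ≤ dist (y a) (y b)) ∧ (∀ j : Fin N, dist (y j) (y i) ≤ R → ¬ Gy (1 / 20) N (y) j) ∧ (∀ j : Fin N, dist (y j) (y i) ≤ R → ¬ ((∀ j' : Fin N, dist (y j') (y j) ≤ R₇ → ¬ Gy (1 / 20) N (y) j') ∧ (∀ z : EuclideanSpace ℝ (Fin 3), dist z (y j) ≤ R₇ → ∃ k : Fin N, dist z (y k) ≤ 1) ∧ (∀ j'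 : Fin N, dist (y j') (y j) ≤ R₇ → (let d : ℝ := sInf ((fun z => dist z (y j')) '' (Set.range (y) \ {(y j')})); ∀ k : Fin N, y k ≠ y j' → dist (y k) (y j') < 27 / 20 * d → 5 ≤ Nat.card {m : Fin N // y m ≠ y j' ∧ dist (y m) (y j') < 27 / 20 * d ∧ y m ≠ y k ∧ dist (y m) (y k) < 27 / 20 * d})))) ∧ (∀ j : Fin N, dist (y j) (y i) ≤ R → ∃ k : Fin N, dist (y k) (y j) ≤ R₈ ∧ Gy (1 / 8) N (y) k) ∧ (∀ j : Fin N, dist (y j) (y i) ≤ R → ¬ ((∀ j' : Fin N, dist (y j') (y j) ≤ R₉ → ¬ Gy (1 / 20) N (y) j') ∧ (Nat.card {j' : Fin N // dist (y j') (y j) ≤ R₉ ∧ ¬ Gy (1 / 8) N (y) j'} : ℝ) ≤ 1 / 2 * (Nat.card {j' : Fin N // dist (y j') (y j) ≤ R₉} : ℝ) ∧ (∀ j' : Fin N, dist (y j') (y j) ≤ R₉ → ¬ Gy (1 / 8) N (y) j' → ¬ (let d : ℝ := sInf ((fun z => dist z (y j')) '' (Set.range (y) \ {(y j')})); ∀ k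 : Fin N, y k ≠ y j' → dist (y k) (y j') < 27 / 20 * d → 5 ≤ Nat.card {m : Fin N // y m ≠ y j' ∧ dist (y m) (y j') < 27 / 20 * d ∧ y m ≠ y k ∧ dist (y m) (y k) < 27 / 20 * d})))); let Appr : MeasureTheory.Measure (EuclideanSpace ℝ (Fin 3)) → ℝ → ℝ → ℝ → Prop := fun μ R₇ R₈ R₉ => ∀ q : EuclideanSpace ℝ (Fin 3), μ {q} ≠ 0 → ∀ R ε : ℝ, 0 < ε → ∃ (N : ℕ) (y : Fin N → EuclideanSpace ℝ (Fin 3)) (i : Fin N), TexBall N y i R R₇ R₈ R₉ ∧ (∀ p : EuclideanSpace ℝ (Fin 3), μ {p} ≠ 0 → dist p q ≤ R → ∃ k : Fin N, dist (y k - y i) (p - q) ≤ ε) ∧ (∀ k : Fin N, dist (y k) (y i) ≤ R → ∃ p : EuclideanSpace ℝ (Fin 3), μ {p} ≠ 0 ∧ dist (y k - y i) (p - q) ≤ ε); ∃ r : ℝ, 0 < r ∧ (∀ μ : MeasureTheory.Measure (EuclideanSpace ℝ (Fin 3)), Literature.Probability.Process.IsRootedHardCore δ μ → Literature.Probability.Process.IsRootedHardCore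 (7 / 10) μ → Appr μ R₇ R₈ R₉ → (∀ p : EuclideanSpace ℝ (Fin 3), μ {p} ≠ 0 → ∀ y : EuclideanSpace ℝ (Fin 3), (∀ q : EuclideanSpace ℝ (Fin 3), μ {q} ≠ 0 → q ≠ p → y ≠ q) → ∑' q : {q : EuclideanSpace ℝ (Fin 3) // μ {q} ≠ 0 ∧ q ≠ p}, Literature.MathematicalPhysics.StatisticalMechanics.lennardJones (dist p (q : EuclideanSpace ℝ (Fin 3))) ≤ ∑' q : {q : EuclideanSpace ℝ (Fin 3) // μ {q} ≠ 0 ∧ q ≠ p}, Literature.MathematicalPhysics.StatisticalMechanics.lennardJones (dist y (q : EuclideanSpace ℝ (Fin 3)))) → (∀ p : EuclideanSpace ℝ (Fin 3), μ {p} ≠ 0 → HasSum (fun q : {q : EuclideanSpace ℝ (Fin 3) // μ {q} ≠ 0 ∧ q ≠ p} => ((dist p (q : EuclideanSpace ℝ (Fin 3)))⁻¹ ^ 8 - (dist p (q : EuclideanSpace ℝ (Fin 3)))⁻¹ ^ 14) • (p - (q : EuclideanSpace ℝ (Fin 3)))) 0 ∧ (∃ L : ℝ, 0 ≤ L ∧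 HasSum (fun q : {q : EuclideanSpace ℝ (Fin 3) // μ {q} ≠ 0 ∧ q ≠ p} => 11 * (dist p (q : EuclideanSpace ℝ (Fin 3)))⁻¹ ^ 14 - 5 * (dist p (q : EuclideanSpace ℝ (Fin 3)))⁻¹ ^ 8) L) ∧ ((∃ q : EuclideanSpace ℝ (Fin 3), μ {q} ≠ 0 ∧ q ≠ p) → ∃ q : EuclideanSpace ℝ (Fin 3), μ {q} ≠ 0 ∧ q ≠ p ∧ dist p q ^ 6 ≤ 11 / 5)) → {p : EuclideanSpace ℝ (Fin 3) | μ {p} ≠ 0}.Infinite → ¬ (∃ Q : Literature.MathematicalPhysics.StatisticalMechanics.PeriodicConfiguration 3, ∃ t : EuclideanSpace ℝ (Fin 3), {p : EuclideanSpace ℝ (Fin 3) | μ {p} ≠ 0} = (fun s => s + t) '' Q.points) → 0 < (∫ y in Metric.closedBall (0 : EuclideanSpace ℝ (Fin 3)) r, (Literature.MathematicalPhysics.StatisticalMechanics.rootEnergy Literature.MathematicalPhysics.StatisticalMechanics.lennardJones (MeasureTheory.Measure.map (fun z : EuclideanSpace ℝ (Fin 3) => z - y) μ) - (⨅ Q :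 Literature.MathematicalPhysics.StatisticalMechanics.PeriodicConfiguration 3, Q.energyPerParticle Literature.MathematicalPhysics.StatisticalMechanics.lennardJones)) / ((MeasureTheory.Measure.map (fun z : EuclideanSpace ℝ (Fin 3) => z - y) μ) (Metric.closedBall (0 : EuclideanSpace ℝ (Fin 3)) r)).toReal ∂μ))) :
    Summit.AtomisticToContinuum.Crystallization.Theses.FrustratedLawDichotomy.AperiodicFrustratedLawGap := by
  intro δ hδ P
  have h' := h δ hδ
  dsimp only at h' ⊢
  intro hP ha hb hd he h0
  obtain ⟨R₇, R₈, R₉, hd'⟩ := hd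
  obtain ⟨r, hr, hprice⟩ := h' R₇ R₈ R₉
  by_contra hlt
  have hmin := not_lt.mp hlt
  have h7 : ∀ᵐ μ ∂P, Literature.Probability.Process.IsRootedHardCore (7 / 10) μ := by
    refine ae_isRootedHardCore_upgrade ha (hd'.mono fun μ hμ q hq R ε hε => ?_)
    obtain ⟨N, y, i, ⟨h1, -, -, -, -⟩, hm1, -⟩ := hμ q hq R ε hε
    exact ⟨N, y, i, h1, hm1⟩
  have hEQ : ∀ᵐ μ ∂P, (∀ p : EuclideanSpace ℝ (Fin 3), μ {p} ≠ 0 → HasSum (fun q : {q : EuclideanSpace ℝ (Fin 3) // μ {q} ≠ 0 ∧ q ≠ p} => ((dist p (q : EuclideanSpace ℝ (Fin 3)))⁻¹ ^ 8 - (dist p (q : EuclideanSpace ℝ (Fin 3)))⁻¹ ^ 14) • (p - (q : EuclideanSpace ℝ (Fin 3)))) 0 ∧ (∃ L : ℝ, 0 ≤ L ∧ HasSum (fun q : {q : EuclideanSpace ℝ (Fin 3) // μ {q} ≠ 0 ∧ q ≠ p} => 11 * (dist p (q : EuclideanSpace ℝ (Fin 3)))⁻¹ ^ 14 - 5 * (dist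 p (q : EuclideanSpace ℝ (Fin 3)))⁻¹ ^ 8) L) ∧ ((∃ q : EuclideanSpace ℝ (Fin 3), μ {q} ≠ 0 ∧ q ≠ p) → ∃ q : EuclideanSpace ℝ (Fin 3), μ {q} ≠ 0 ∧ q ≠ p ∧ dist p q ^ 6 ≤ 11 / 5)) := by
    filter_upwards [ae_forceBalance_of_nash (by norm_num : (0 : ℝ) < 7 / 10) h7 he,
      ae_laplacian_nonneg_of_nash (by norm_num : (0 : ℝ) < 7 / 10) h7 he,
      ae_exists_near_of_nash (by norm_num : (0 : ℝ) < 7 / 10) h7 he] with μ h₀ h₁ h₂ p hp using ⟨h₀ p hp, h₁ p hp, h₂ p hp⟩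
  have hinf : ∀ᵐ μ ∂P, {p : EuclideanSpace ℝ (Fin 3) | μ {p} ≠ 0}.Infinite :=
    ae_infinite_of_minimising_of_decl Summit.AtomisticToContinuum.Crystallization.Theorems.unimodularEnergyLowerBound_proof
      hδ ha hb hmin
  have hnp : ∀ᵐ μ ∂P, ¬ (∃ Q : Literature.MathematicalPhysics.StatisticalMechanics.PeriodicConfiguration 3, ∃ t : EuclideanSpace ℝ (Fin 3), {p : EuclideanSpace ℝ (Fin 3) | μ {p} ≠ 0} = (fun s => s + t) '' Q.points) := by
    have := measure_eq_zero_iff_ae_notMem.mp h0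
    filter_upwards [this] with μ hμ
    simpa only [Set.mem_setOf_eq] using hμ
  refine hlt (eStar_lt_integral_rootEnergy_of_ae_surplusSharing h7 hb hr ?_)
  filter_upwards [ha, h7, hd', he, hEQ, hinf, hnp] with μ haμ h7μ hdμ heμ hEμ hiμ hnμ
  have hp := hprice μ haμ h7μ hdμ heμ hEμ hiμ hnμ
  have heq := (surplus_toReal_sub_eq_integral h7μ hr
    (⨅ Q : PeriodicConfiguration 3, Q.energyPerParticle lennardJones)).2
  linarith

/-- **REAL-SURPLUS DOOR for the registered stub** (`S_aperiodicErgodicGap` verbatim). [folklore] -/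
theorem aperiodicErgodicGap_of_realSurplusPrice
    (h : ∀ δ : ℝ, 0 < δ → ∀ R₇ R₈ R₉ : ℝ, let Gy : ℝ → (N : ℕ) → (Fin N → EuclideanSpace ℝ (Fin 3)) → Fin N → Prop := fun η N y j => let d : ℝ := sInf ((fun z => dist z (y (j : Fin N))) '' (Set.range (y) \ {(y (j : Fin N))})); let T : Set (EuclideanSpace ℝ (Fin 3)) := {z : EuclideanSpace ℝ (Fin 3) | z ∈ Set.range (y) ∧ z ≠ (y (j : Fin N)) ∧ dist z (y (j : Fin N)) < 13 / 10 * d}; ∃ A : EuclideanSpace ℝ (Fin 3) →ₗᵢ[ℝ] EuclideanSpace ℝ (Fin 3), (∃ e : ↥T ≃ ↥Literature.Geometry.DiscreteGeometry.fccKissingPattern, ∀ t : ↥T, dist (d⁻¹ • ((t : EuclideanSpace ℝ (Fin 3)) - (y (j : Fin N)))) (A ((e t : ↥Literature.Geometry.DiscreteGeometry.fccKissingPattern) : EuclideanSpace ℝ (Fin 3))) ≤ η) ∨ (∃ e : ↥T ≃ ↥Literature.Geometry.DiscreteGeometry.hcpKissingPattern, ∀ t : ↥T, dist (d⁻¹ •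 ((t : EuclideanSpace ℝ (Fin 3)) - (y (j : Fin N)))) (A ((e t : ↥Literature.Geometry.DiscreteGeometry.hcpKissingPattern) : EuclideanSpace ℝ (Fin 3))) ≤ η); let TexBall : (N : ℕ) → (Fin N → EuclideanSpace ℝ (Fin 3)) → Fin N → ℝ → ℝ → ℝ → ℝ → Prop := fun N y i R R₇ R₈ R₉ => (∀ a b : Fin N, a ≠ b → (7 : ℝ) / 10 ≤ dist (y a) (y b)) ∧ (∀ j : Fin N, dist (y j) (y i) ≤ R → ¬ Gy (1 / 20) N (y) j) ∧ (∀ j : Fin N, dist (y j) (y i) ≤ R → ¬ ((∀ j' : Fin N, dist (y j') (y j) ≤ R₇ → ¬ Gy (1 / 20) N (y) j') ∧ (∀ z : EuclideanSpace ℝ (Fin 3), dist z (y j) ≤ R₇ → ∃ k : Fin N, dist z (y k) ≤ 1) ∧ (∀ j' : Fin N, dist (y j') (y j) ≤ R₇ → (let d : ℝ := sInf ((fun z => dist z (y j')) '' (Set.range (y) \ {(y j')})); ∀ k : Fin N, y k ≠ y j' → dist (y k) (y j') < 27 / 20 * d → 5 ≤ Nat.card {m : Fin N // y m ≠ y j'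 ∧ dist (y m) (y j') < 27 / 20 * d ∧ y m ≠ y k ∧ dist (y m) (y k) < 27 / 20 * d})))) ∧ (∀ j : Fin N, dist (y j) (y i) ≤ R → ∃ k : Fin N, dist (y k) (y j) ≤ R₈ ∧ Gy (1 / 8) N (y) k) ∧ (∀ j : Fin N, dist (y j) (y i) ≤ R → ¬ ((∀ j' : Fin N, dist (y j') (y j) ≤ R₉ → ¬ Gy (1 / 20) N (y) j') ∧ (Nat.card {j' : Fin N // dist (y j') (y j) ≤ R₉ ∧ ¬ Gy (1 / 8) N (y) j'} : ℝ) ≤ 1 / 2 * (Nat.card {j' : Fin N // dist (y j') (y j) ≤ R₉} : ℝ) ∧ (∀ j' : Fin N, dist (y j') (y j) ≤ R₉ → ¬ Gy (1 / 8) N (y) j' → ¬ (let d : ℝ := sInf ((fun z => dist z (y j')) '' (Set.range (y) \ {(y j')})); ∀ k : Fin N, y k ≠ y j' → dist (y k) (y j') < 27 / 20 * d → 5 ≤ Nat.card {m : Fin N // y m ≠ y j' ∧ dist (y m) (y j') < 27 / 20 * d ∧ y m ≠ y k ∧ dist (y m) (y k) < 27 / 20 * d})))); let Appr : MeasureTheory.Measure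 (EuclideanSpace ℝ (Fin 3)) → ℝ → ℝ → ℝ → Prop := fun μ R₇ R₈ R₉ => ∀ q : EuclideanSpace ℝ (Fin 3), μ {q} ≠ 0 → ∀ R ε : ℝ, 0 < ε → ∃ (N : ℕ) (y : Fin N → EuclideanSpace ℝ (Fin 3)) (i : Fin N), TexBall N y i R R₇ R₈ R₉ ∧ (∀ p : EuclideanSpace ℝ (Fin 3), μ {p} ≠ 0 → dist p q ≤ R → ∃ k : Fin N, dist (y k - y i) (p - q) ≤ ε) ∧ (∀ k : Fin N, dist (y k) (y i) ≤ R → ∃ p : EuclideanSpace ℝ (Fin 3), μ {p} ≠ 0 ∧ dist (y k - y i) (p - q) ≤ ε); ∃ r : ℝ, 0 < r ∧ (∀ μ : MeasureTheory.Measure (EuclideanSpace ℝ (Fin 3)), Literature.Probability.Process.IsRootedHardCore δ μ → Literature.Probability.Process.IsRootedHardCore (7 / 10) μ → Appr μ R₇ R₈ R₉ → (∀ p : EuclideanSpace ℝ (Fin 3), μ {p} ≠ 0 → ∀ y : EuclideanSpace ℝ (Fin 3), (∀ q : EuclideanSpace ℝ (Fin 3), μ {q} ≠ 0 → q ≠ p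 → y ≠ q) → ∑' q : {q : EuclideanSpace ℝ (Fin 3) // μ {q} ≠ 0 ∧ q ≠ p}, Literature.MathematicalPhysics.StatisticalMechanics.lennardJones (dist p (q : EuclideanSpace ℝ (Fin 3))) ≤ ∑' q : {q : EuclideanSpace ℝ (Fin 3) // μ {q} ≠ 0 ∧ q ≠ p}, Literature.MathematicalPhysics.StatisticalMechanics.lennardJones (dist y (q : EuclideanSpace ℝ (Fin 3)))) → (∀ p : EuclideanSpace ℝ (Fin 3), μ {p} ≠ 0 → HasSum (fun q : {q : EuclideanSpace ℝ (Fin 3) // μ {q} ≠ 0 ∧ q ≠ p} => ((dist p (q : EuclideanSpace ℝ (Fin 3)))⁻¹ ^ 8 - (dist p (q : EuclideanSpace ℝ (Fin 3)))⁻¹ ^ 14) • (p - (q : EuclideanSpace ℝ (Fin 3)))) 0 ∧ (∃ L : ℝ, 0 ≤ L ∧ HasSum (fun q : {q : EuclideanSpace ℝ (Fin 3) // μ {q} ≠ 0 ∧ q ≠ p} => 11 * (dist p (q : EuclideanSpace ℝ (Fin 3)))⁻¹ ^ 14 - 5 * (dist p (q : EuclideanSpace ℝ (Fin 3)))⁻¹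 ^ 8) L) ∧ ((∃ q : EuclideanSpace ℝ (Fin 3), μ {q} ≠ 0 ∧ q ≠ p) → ∃ q : EuclideanSpace ℝ (Fin 3), μ {q} ≠ 0 ∧ q ≠ p ∧ dist p q ^ 6 ≤ 11 / 5)) → {p : EuclideanSpace ℝ (Fin 3) | μ {p} ≠ 0}.Infinite → ¬ (∃ Q : Literature.MathematicalPhysics.StatisticalMechanics.PeriodicConfiguration 3, ∃ t : EuclideanSpace ℝ (Fin 3), {p : EuclideanSpace ℝ (Fin 3) | μ {p} ≠ 0} = (fun s => s + t) '' Q.points) → 0 < (∫ y in Metric.closedBall (0 : EuclideanSpace ℝ (Fin 3)) r, (Literature.MathematicalPhysics.StatisticalMechanics.rootEnergy Literature.MathematicalPhysics.StatisticalMechanics.lennardJones (MeasureTheory.Measure.map (fun z : EuclideanSpace ℝ (Fin 3) => z - y) μ) - (⨅ Q : Literature.MathematicalPhysics.StatisticalMechanics.PeriodicConfiguration 3, Q.energyPerParticle Literature.MathematicalPhysics.StatisticalMechanics.lennardJones)) / ((MeasureTheory.Measure.map (fun z : EuclideanSpace ℝ (Fin 3) => z - y) μ) (Metric.closedBall (0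 : EuclideanSpace ℝ (Fin 3)) r)).toReal ∂μ))) :
    ∀ δ : ℝ, 0 < δ → ∀ P : MeasureTheory.Measure (MeasureTheory.Measure (EuclideanSpace ℝ (Fin 3))), let Gy : ℝ → (N : ℕ) → (Fin N → EuclideanSpace ℝ (Fin 3)) → Fin N → Prop := fun η N y j => let d : ℝ := sInf ((fun z => dist z (y (j : Fin N))) '' (Set.range (y) \ {(y (j : Fin N))})); let T : Set (EuclideanSpace ℝ (Fin 3)) := {z : EuclideanSpace ℝ (Fin 3) | z ∈ Set.range (y) ∧ z ≠ (y (j : Fin N)) ∧ dist z (y (j : Fin N)) < 13 / 10 * d}; ∃ A : EuclideanSpace ℝ (Fin 3) →ₗᵢ[ℝ] EuclideanSpace ℝ (Fin 3), (∃ e : ↥T ≃ ↥Literature.Geometry.DiscreteGeometry.fccKissingPattern, ∀ t : ↥T, dist (d⁻¹ • ((t : EuclideanSpace ℝ (Fin 3)) - (y (j : Fin N)))) (A ((e t : ↥Literature.Geometry.DiscreteGeometry.fccKissingPattern) : EuclideanSpace ℝ (Fin 3))) ≤ η) ∨ (∃ e : ↥T ≃ ↥Literature.Geometry.DiscreteGeometry.hcpKissingPattern,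 ∀ t : ↥T, dist (d⁻¹ • ((t : EuclideanSpace ℝ (Fin 3)) - (y (j : Fin N)))) (A ((e t : ↥Literature.Geometry.DiscreteGeometry.hcpKissingPattern) : EuclideanSpace ℝ (Fin 3))) ≤ η); let TexBall : (N : ℕ) → (Fin N → EuclideanSpace ℝ (Fin 3)) → Fin N → ℝ → ℝ → ℝ → ℝ → Prop := fun N y i R R₇ R₈ R₉ => (∀ a b : Fin N, a ≠ b → (7 : ℝ) / 10 ≤ dist (y a) (y b)) ∧ (∀ j : Fin N, dist (y j) (y i) ≤ R → ¬ Gy (1 / 20) N (y) j) ∧ (∀ j : Fin N, dist (y j) (y i) ≤ R → ¬ ((∀ j' : Fin N, dist (y j') (y j) ≤ R₇ → ¬ Gy (1 / 20) N (y) j') ∧ (∀ z : EuclideanSpace ℝ (Fin 3), dist z (y j) ≤ R₇ → ∃ k : Fin N, dist z (y k) ≤ 1) ∧ (∀ j' : Fin N, dist (y j') (y j) ≤ R₇ → (let d : ℝ := sInf ((fun z => dist z (y j')) '' (Set.range (y) \ {(y j')})); ∀ k : Fin N, y k ≠ y j' → dist (y k) (y j') < 27 / 20 * d → 5 ≤ Nat.card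 {m : Fin N // y m ≠ y j' ∧ dist (y m) (y j') < 27 / 20 * d ∧ y m ≠ y k ∧ dist (y m) (y k) < 27 / 20 * d})))) ∧ (∀ j : Fin N, dist (y j) (y i) ≤ R → ∃ k : Fin N, dist (y k) (y j) ≤ R₈ ∧ Gy (1 / 8) N (y) k) ∧ (∀ j : Fin N, dist (y j) (y i) ≤ R → ¬ ((∀ j' : Fin N, dist (y j') (y j) ≤ R₉ → ¬ Gy (1 / 20) N (y) j') ∧ (Nat.card {j' : Fin N // dist (y j') (y j) ≤ R₉ ∧ ¬ Gy (1 / 8) N (y) j'} : ℝ) ≤ 1 / 2 * (Nat.card {j' : Fin N // dist (y j') (y j) ≤ R₉} : ℝ) ∧ (∀ j' : Fin N, dist (y j') (y j) ≤ R₉ → ¬ Gy (1 / 8) N (y) j' → ¬ (let d : ℝ := sInf ((fun z => dist z (y j')) '' (Set.range (y) \ {(y j')})); ∀ k : Fin N, y k ≠ y j' → dist (y k) (y j') < 27 / 20 * d → 5 ≤ Nat.card {m : Fin N // y m ≠ y j' ∧ dist (y m) (y j') < 27 / 20 * d ∧ y m ≠ y k ∧ dist (y m) (y k) < 27 / 20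 * d})))); let Appr : MeasureTheory.Measure (EuclideanSpace ℝ (Fin 3)) → ℝ → ℝ → ℝ → Prop := fun μ R₇ R₈ R₉ => ∀ q : EuclideanSpace ℝ (Fin 3), μ {q} ≠ 0 → ∀ R ε : ℝ, 0 < ε → ∃ (N : ℕ) (y : Fin N → EuclideanSpace ℝ (Fin 3)) (i : Fin N), TexBall N y i R R₇ R₈ R₉ ∧ (∀ p : EuclideanSpace ℝ (Fin 3), μ {p} ≠ 0 → dist p q ≤ R → ∃ k : Fin N, dist (y k - y i) (p - q) ≤ ε) ∧ (∀ k : Fin N, dist (y k) (y i) ≤ R → ∃ p : EuclideanSpace ℝ (Fin 3), μ {p} ≠ 0 ∧ dist (y k - y i) (p - q) ≤ ε); MeasureTheory.IsProbabilityMeasure P → (∀ᵐ μ ∂P, Literature.Probability.Process.IsRootedHardCore δ μ) → Literature.Probability.Process.IsPointStationaryLaw P → (∃ R₇ R₈ R₉ : ℝ, ∀ᵐ μ ∂P, Appr μ R₇ R₈ R₉) → (∀ᵐ μ ∂P, ∀ p : EuclideanSpace ℝ (Fin 3), μ {p} ≠ 0 → ∀ y : EuclideanSpace ℝ (Fin 3),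 (∀ q : EuclideanSpace ℝ (Fin 3), μ {q} ≠ 0 → q ≠ p → y ≠ q) → ∑' q : {q : EuclideanSpace ℝ (Fin 3) // μ {q} ≠ 0 ∧ q ≠ p}, Literature.MathematicalPhysics.StatisticalMechanics.lennardJones (dist p (q : EuclideanSpace ℝ (Fin 3))) ≤ ∑' q : {q : EuclideanSpace ℝ (Fin 3) // μ {q} ≠ 0 ∧ q ≠ p}, Literature.MathematicalPhysics.StatisticalMechanics.lennardJones (dist y (q : EuclideanSpace ℝ (Fin 3)))) → P {μ : MeasureTheory.Measure (EuclideanSpace ℝ (Fin 3)) | ∃ Q : Literature.MathematicalPhysics.StatisticalMechanics.PeriodicConfiguration 3, ∃ t : EuclideanSpace ℝ (Fin 3), {p : EuclideanSpace ℝ (Fin 3) | μ {p} ≠ 0} = (fun s => s + t) '' Q.points} = 0 → (∀ A : Set (MeasureTheory.Measure (EuclideanSpace ℝ (Fin 3))), MeasurableSet A → (∀ μ : MeasureTheory.Measure (EuclideanSpace ℝ (Fin 3)), ∀ p : EuclideanSpace ℝ (Fin 3), μ {p} ≠ 0 → (μ ∈ A ↔ MeasureTheory.Measure.map (fun z : EuclideanSpace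 ℝ (Fin 3) => z - p) μ ∈ A)) → P A = 0 ∨ P Aᶜ = 0) → (⨅ Q : Literature.MathematicalPhysics.StatisticalMechanics.PeriodicConfiguration 3, Q.energyPerParticle Literature.MathematicalPhysics.StatisticalMechanics.lennardJones) < (∫ μ, Literature.MathematicalPhysics.StatisticalMechanics.rootEnergy Literature.MathematicalPhysics.StatisticalMechanics.lennardJones μ ∂P) := by
  have hc := aperiodicFrustratedLawGap_of_realSurplusPrice h
  intro δ hδ P
  have h' := hc δ hδ P
  dsimp only at h' ⊢
  intro hP ha hb hd he h0 _
  exact h' hP ha hb hd he h0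

/-- **REAL-SURPLUS DOOR for the `PeriodicChargeSplit` copy.** [folklore] -/
theorem periodicChargeSplit_aperiodicFrustratedLawGap_of_realSurplusPrice
    (h : ∀ δ : ℝ, 0 < δ → ∀ R₇ R₈ R₉ : ℝ, let Gy : ℝ → (N : ℕ) → (Fin N → EuclideanSpace ℝ (Fin 3)) → Fin N → Prop := fun η N y j => let d : ℝ := sInf ((fun z => dist z (y (j : Fin N))) '' (Set.range (y) \ {(y (j : Fin N))})); let T : Set (EuclideanSpace ℝ (Fin 3)) := {z : EuclideanSpace ℝ (Fin 3) | z ∈ Set.range (y) ∧ z ≠ (y (j : Fin N)) ∧ dist z (y (j : Fin N)) < 13 / 10 * d}; ∃ A : EuclideanSpace ℝ (Fin 3) →ₗᵢ[ℝ] EuclideanSpace ℝ (Fin 3), (∃ e : ↥T ≃ ↥Literature.Geometry.DiscreteGeometry.fccKissingPattern, ∀ t : ↥T, dist (d⁻¹ • ((t : EuclideanSpace ℝ (Fin 3)) - (y (j : Fin N)))) (A ((e t : ↥Literature.Geometry.DiscreteGeometry.fccKissingPattern) : EuclideanSpace ℝ (Fin 3))) ≤ η) ∨ (∃ e : ↥T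 ≃ ↥Literature.Geometry.DiscreteGeometry.hcpKissingPattern, ∀ t : ↥T, dist (d⁻¹ • ((t : EuclideanSpace ℝ (Fin 3)) - (y (j : Fin N)))) (A ((e t : ↥Literature.Geometry.DiscreteGeometry.hcpKissingPattern) : EuclideanSpace ℝ (Fin 3))) ≤ η); let TexBall : (N : ℕ) → (Fin N → EuclideanSpace ℝ (Fin 3)) → Fin N → ℝ → ℝ → ℝ → ℝ → Prop := fun N y i R R₇ R₈ R₉ => (∀ a b : Fin N, a ≠ b → (7 : ℝ) / 10 ≤ dist (y a) (y b)) ∧ (∀ j : Fin N, dist (y j) (y i) ≤ R → ¬ Gy (1 / 20) N (y) j) ∧ (∀ j : Fin N, dist (y j) (y i) ≤ R → ¬ ((∀ j' : Fin N, dist (y j') (y j) ≤ R₇ → ¬ Gy (1 / 20) N (y) j') ∧ (∀ z : EuclideanSpace ℝ (Fin 3), dist z (y j) ≤ R₇ → ∃ k : Fin N, dist z (y k) ≤ 1) ∧ (∀ j' : Fin N, dist (y j') (y j) ≤ R₇ → (let d : ℝ := sInf ((fun z => dist z (y j')) '' (Set.range (y) \ {(y j')})); ∀ k : Fin N, y k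 ≠ y j' → dist (y k) (y j') < 27 / 20 * d → 5 ≤ Nat.card {m : Fin N // y m ≠ y j' ∧ dist (y m) (y j') < 27 / 20 * d ∧ y m ≠ y k ∧ dist (y m) (y k) < 27 / 20 * d})))) ∧ (∀ j : Fin N, dist (y j) (y i) ≤ R → ∃ k : Fin N, dist (y k) (y j) ≤ R₈ ∧ Gy (1 / 8) N (y) k) ∧ (∀ j : Fin N, dist (y j) (y i) ≤ R → ¬ ((∀ j' : Fin N, dist (y j') (y j) ≤ R₉ → ¬ Gy (1 / 20) N (y) j') ∧ (Nat.card {j' : Fin N // dist (y j') (y j) ≤ R₉ ∧ ¬ Gy (1 / 8) N (y) j'} : ℝ) ≤ 1 / 2 * (Nat.card {j' : Fin N // dist (y j') (y j) ≤ R₉} : ℝ) ∧ (∀ j' : Fin N, dist (y j') (y j) ≤ R₉ → ¬ Gy (1 / 8) N (y) j' → ¬ (let d : ℝ := sInf ((fun z => dist z (y j')) '' (Set.range (y) \ {(y j')})); ∀ k : Fin N, y k ≠ y j' → dist (y k) (y j') < 27 / 20 * d → 5 ≤ Nat.card {m : Fin N // y m ≠ y j' ∧ dist (y m) (y j') < 27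 / 20 * d ∧ y m ≠ y k ∧ dist (y m) (y k) < 27 / 20 * d})))); let Appr : MeasureTheory.Measure (EuclideanSpace ℝ (Fin 3)) → ℝ → ℝ → ℝ → Prop := fun μ R₇ R₈ R₉ => ∀ q : EuclideanSpace ℝ (Fin 3), μ {q} ≠ 0 → ∀ R ε : ℝ, 0 < ε → ∃ (N : ℕ) (y : Fin N → EuclideanSpace ℝ (Fin 3)) (i : Fin N), TexBall N y i R R₇ R₈ R₉ ∧ (∀ p : EuclideanSpace ℝ (Fin 3), μ {p} ≠ 0 → dist p q ≤ R → ∃ k : Fin N, dist (y k - y i) (p - q) ≤ ε) ∧ (∀ k : Fin N, dist (y k) (y i) ≤ R → ∃ p : EuclideanSpace ℝ (Fin 3), μ {p} ≠ 0 ∧ dist (y k - y i) (p - q) ≤ ε); ∃ r : ℝ, 0 < r ∧ (∀ μ : MeasureTheory.Measure (EuclideanSpace ℝ (Fin 3)), Literature.Probability.Process.IsRootedHardCore δ μ → Literature.Probability.Process.IsRootedHardCore (7 / 10) μ → Appr μ R₇ R₈ R₉ → (∀ p : EuclideanSpace ℝ (Fin 3), μ {p} ≠ 0 → ∀ y : EuclideanSpace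 ℝ (Fin 3), (∀ q : EuclideanSpace ℝ (Fin 3), μ {q} ≠ 0 → q ≠ p → y ≠ q) → ∑' q : {q : EuclideanSpace ℝ (Fin 3) // μ {q} ≠ 0 ∧ q ≠ p}, Literature.MathematicalPhysics.StatisticalMechanics.lennardJones (dist p (q : EuclideanSpace ℝ (Fin 3))) ≤ ∑' q : {q : EuclideanSpace ℝ (Fin 3) // μ {q} ≠ 0 ∧ q ≠ p}, Literature.MathematicalPhysics.StatisticalMechanics.lennardJones (dist y (q : EuclideanSpace ℝ (Fin 3)))) → (∀ p : EuclideanSpace ℝ (Fin 3), μ {p} ≠ 0 → HasSum (fun q : {q : EuclideanSpace ℝ (Fin 3) // μ {q} ≠ 0 ∧ q ≠ p} => ((dist p (q : EuclideanSpace ℝ (Fin 3)))⁻¹ ^ 8 - (dist p (q : EuclideanSpace ℝ (Fin 3)))⁻¹ ^ 14) • (p - (q : EuclideanSpace ℝ (Fin 3)))) 0 ∧ (∃ L : ℝ, 0 ≤ L ∧ HasSum (fun q : {q : EuclideanSpace ℝ (Fin 3) // μ {q} ≠ 0 ∧ q ≠ p} => 11 * (dist p (q : EuclideanSpace ℝ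 (Fin 3)))⁻¹ ^ 14 - 5 * (dist p (q : EuclideanSpace ℝ (Fin 3)))⁻¹ ^ 8) L) ∧ ((∃ q : EuclideanSpace ℝ (Fin 3), μ {q} ≠ 0 ∧ q ≠ p) → ∃ q : EuclideanSpace ℝ (Fin 3), μ {q} ≠ 0 ∧ q ≠ p ∧ dist p q ^ 6 ≤ 11 / 5)) → {p : EuclideanSpace ℝ (Fin 3) | μ {p} ≠ 0}.Infinite → ¬ (∃ Q : Literature.MathematicalPhysics.StatisticalMechanics.PeriodicConfiguration 3, ∃ t : EuclideanSpace ℝ (Fin 3), {p : EuclideanSpace ℝ (Fin 3) | μ {p} ≠ 0} = (fun s => s + t) '' Q.points) → 0 < (∫ y in Metric.closedBall (0 : EuclideanSpace ℝ (Fin 3)) r, (Literature.MathematicalPhysics.StatisticalMechanics.rootEnergy Literature.MathematicalPhysics.StatisticalMechanics.lennardJones (MeasureTheory.Measure.map (fun z : EuclideanSpace ℝ (Fin 3) => z - y) μ) - (⨅ Q : Literature.MathematicalPhysics.StatisticalMechanics.PeriodicConfiguration 3, Q.energyPerParticle Literature.MathematicalPhysics.StatisticalMechanics.lennardJones)) /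 ((MeasureTheory.Measure.map (fun z : EuclideanSpace ℝ (Fin 3) => z - y) μ) (Metric.closedBall (0 : EuclideanSpace ℝ (Fin 3)) r)).toReal ∂μ))) :
    Summit.AtomisticToContinuum.Crystallization.Theses.PeriodicChargeSplit.AperiodicFrustratedLawGap :=
  periodicChargeSplit_aperiodicFrustratedLawGap_iff_ergodicCase.mpr (aperiodicErgodicGap_of_realSurplusPrice h)

end Summit.AtomisticToContinuum.Crystallization.Theorems.FrustratedLawDichotomyTransportPriceReal

end
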